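import Literature.Geometry.Kaehler.ComplexTorusSubtorusCycleClass
import HarnessLib

/-!
# The cycle class of a complex subtorus, II: it depends only on the subtorus; `[X] = 1`

Layer `Literature/Geometry/Kaehler`, namespace `Literature.Geometry.Kaehler.ComplexTorus`; lane
`lit-hodgefound`, Layer A4, row A4-18 / P-pre-23(b) (prover `lit-hodgefound-p08`), sequel of
`ComplexTorusSubtorusCycleClass.lean` (`volumeForm`, `torusIntegral`, `cycleFormOfFrame`,
`SubtorusFrame`, `SubtorusFrame.cycleForm`: `[Z] = (Φu) ⌟ vol`, `∫_X η ∧ [Z] = ∫_Z η`, uniqueness).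

* `AlternatingMap.map_matrix_smul_sum` / `ContinuousAlternatingMap.map_matrix_smul_sum` — **an
  alternating form on a matrix combination of a frame**: `f (∑ᵢ A i j • uᵢ)ⱼ = det A • f(u)`
  (Warner (1983), 2.6 (b): linear substitutions act on `Λ_n` by the determinant; Mathlib has the
  special case `Basis.det_comp`).
* `IsPosOriented.comp_linearEquiv`, `isPosOriented_comp_linearEquiv_iff` — complex-linear
  isomorphisms preserve the canonical orientation (Griffiths–Harris, Ch. 0 §2).
* `exists_orientationSign_eq_one` — the lattice basis admits a positively oriented enumeration;
  **`SubtorusFrame.univ`** — the whole torus `X` as a subtorus datum (codimension `0`), and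
  **`SubtorusFrame.cycleForm_univ`: `[X] = 1 ∈ H⁰(X, ℤ)`** (Lange (2023), proof of Prop. 6.2.20:
  `cl` of the whole variety is `1`; dually `∫_X vol = 1`).
* **`SubtorusFrame.apply_latticeTuple_eq_of_realSpan_eq`** — two saturated, positively oriented
  lattice frames with the same real span `W` differ by a matrix `M ∈ SL_m(ℤ)` (`GL_m(ℤ)` by saturation,
  `det M > 0` by the orientations), so every alternating `m`-form takes the same value on them
  (`∫_Z η` is well defined); hence **`SubtorusFrame.cycleForm_eq_of_realSpan_eq`,
  `cycleClass_eq_of_realSpan_eq`: the cycle class `[Z]` depends only on the complex subtorus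
  `Z = π(a + W)`, not on the oriented `ℤ`-basis of `W ∩ Λ` presenting it** (Voisin (2002), Remark
  11.16: `PD([Z])` is the homology class of the oriented submanifold `Z`), and
  `carrier_eq_of_realSpan_eq`.

Everything is proved; no named fact is introduced.

## References

* [Lange2023AbelianVarietiesComplex] H. Lange, *Abelian Varieties over the Complex Numbers* (2023),
  §1.1.2, §6.2.4 p. 310 (Poincaré duality; proof of Prop. 6.2.20).
* [Voisin2002] C. Voisin, *Hodge Theory and Complex Algebraic Geometry I* (2002), §11.1.2, Cor. 11.15,
  Remark 11.16.
* [LangeBirkenhake1992] H. Lange, Ch. Birkenhake, *Complex Abelian Varieties* (1992), Exercise 1.1.6 (2)(a).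
* [WarnerGTM94] F. W. Warner, *Foundations of Differentiable Manifolds and Lie Groups* (1983), 2.6 (b),
  Exercise 2.13.
-/

noncomputable section

open scoped Manifold ContDiff Topology Real
open Set Function Complex Finset Module
open Literature.LinearAlgebra.Alternating

/-! ### Alternating maps on matrix combinations of a frame: `f(u · A) = det A · f(u)` -/

/-- **An alternating form evaluated on a matrix combination of a frame**: for an alternating map `f`
in `ι` arguments, a frame `u : ι → M` and a square matrix `A`,
`f (∑ᵢ A i j • uᵢ)ⱼ = det A • f(u)` (Warner (1983), 2.6 (b): in top degree linear substitutions act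
by the determinant; proof: expand by multilinearity over all maps `r : ι → ι`, only the permutations
survive). [cite: WarnerGTM94, 2.6 (b)] -/
theorem AlternatingMap.map_matrix_smul_sum {R M N ι : Type*} [CommRing R] [AddCommGroup M]
    [Module R M] [AddCommGroup N] [Module R N] [Fintype ι] [DecidableEq ι]
    (f : M [⋀^ι]→ₗ[R] N) (u : ι → M) (A : Matrix ι ι R) :
    f (fun j ↦ ∑ i, A i j • u i) = A.det • f u := by
  classical
  have h1 : f (fun j ↦ ∑ i, A i j • u i) = ∑ r : ι → ι, f (fun j ↦ A (r j) j • u (r j)) := by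
    have h := f.toMultilinearMap.map_sum (fun j i ↦ A i j • u i)
    simpa only [AlternatingMap.coe_multilinearMap] using h
  have h2 : ∀ r : ι → ι, f (fun j ↦ A (r j) j • u (r j)) = (∏ j, A (r j) j) • f (u ∘ r) := fun r ↦ by
    have h := f.toMultilinearMap.map_smul_univ (fun j ↦ A (r j) j) (u ∘ r)
    simpa only [AlternatingMap.coe_multilinearMap, Function.comp_apply] using h
  rw [h1]
  simp_rw [h2]
  -- restrict the sum to permutations
  let emb : Equiv.Perm ι ↪ (ι → ι) := ⟨fun σ ↦ ⇑σ, Equiv.coe_fn_injective⟩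
  have h3 : ∑ r : ι → ι, (∏ j, A (r j) j) • f (u ∘ r) =
      ∑ r ∈ Finset.univ.map emb, (∏ j, A (r j) j) • f (u ∘ r) := by
    refine (Finset.sum_subset (Finset.subset_univ _) fun r _ hr ↦ ?_).symm
    have hinj : ¬ Function.Injective r := fun hi ↦ hr (Finset.mem_map.2
      ⟨Equiv.ofBijective r (Finite.injective_iff_bijective.mp hi), Finset.mem_univ _, rfl⟩)
    rw [f.map_eq_zero_of_not_injective (u ∘ r) (fun h ↦ hinj (Function.Injective.of_comp h)),
      smul_zero]
  rw [h3, Finset.sum_map, Matrix.det_apply, Finset.sum_smul]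
  refine Finset.sum_congr rfl fun σ _ ↦ ?_
  change (∏ j, A (σ j) j) • f (u ∘ ⇑σ) = _
  rw [AlternatingMap.map_perm, Units.smul_def, Units.smul_def, zsmul_eq_mul,
    ← Int.cast_smul_eq_zsmul R, smul_smul, mul_comm]

/-- Continuous version: `f (∑ᵢ A i j • uᵢ)ⱼ = det A • f(u)` for a continuous alternating map.
[cite: WarnerGTM94, 2.6 (b)] -/
theorem ContinuousAlternatingMap.map_matrix_smul_sum {R M N ι : Type*} [CommRing R] [AddCommGroup M]
    [Module R M] [TopologicalSpace M] [AddCommGroup N] [Module R N] [TopologicalSpace N]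
    [Fintype ι] [DecidableEq ι] (f : M [⋀^ι]→L[R] N) (u : ι → M) (A : Matrix ι ι R) :
    f (fun j ↦ ∑ i, A i j • u i) = A.det • f u := by
  rw [← ContinuousAlternatingMap.coe_toAlternatingMap, AlternatingMap.map_matrix_smul_sum]

namespace Literature.Geometry.Kaehler

/-! ### Transport of positive orientation along complex-linear isomorphisms -/

section Transport

variable {W W' : Type*} [AddCommGroup W] [Module ℂ W] [AddCommGroup W'] [Module ℂ W'] {q N : ℕ}

/-- The real basis of a transported complex basis is the transported real basis.
[cite: Voisin2002, §11.1.2 Cor. 11.15] -/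
theorem realBasisOfComplex_map (b : Basis (Fin q) ℂ W) (φ : W ≃ₗ[ℂ] W') :
    realBasisOfComplex (b.map φ) = (realBasisOfComplex b).map (φ.restrictScalars ℝ) := by
  refine Basis.eq_of_apply_eq fun x ↦ ?_
  rw [realBasisOfComplex_apply, Basis.map_apply, Basis.map_apply, realBasisOfComplex_apply,
    LinearEquiv.restrictScalars_apply, map_smul]

/-- **Complex-linear isomorphisms preserve positive orientation.** [cite: Voisin2002, §11.1.2 Cor. 11.15] -/
theorem IsPosOriented.comp_linearEquiv {v : Fin N → W} (hv : IsPosOriented v) (φ : W ≃ₗ[ℂ] W') :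
    IsPosOriented (⇑φ ∘ v) := by
  classical
  obtain ⟨q, h, b, hb⟩ := hv
  refine ⟨q, h, b.map φ, ?_⟩
  have hre : (realBasisOfComplex (b.map φ)).reindex (finCongr h) =
      ((realBasisOfComplex b).reindex (finCongr h)).map (φ.restrictScalars ℝ) := by
    refine Basis.eq_of_apply_eq fun x ↦ ?_
    simp only [Basis.reindex_apply, Basis.map_apply, realBasisOfComplex_map]
  rw [hre, Basis.det_map]
  have hc : ⇑(φ.restrictScalars ℝ).symm ∘ (⇑φ ∘ v) = v := by
    funext j
    simp only [comp_apply]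
    exact φ.symm_apply_apply (v j)
  rw [hc]
  exact hb

/-- Positive orientation is invariant under complex-linear isomorphisms. [cite: Voisin2002, §11.1.2 Cor. 11.15] -/
theorem isPosOriented_comp_linearEquiv_iff (φ : W ≃ₗ[ℂ] W') (v : Fin N → W) :
    IsPosOriented (⇑φ ∘ v) ↔ IsPosOriented v := by
  refine ⟨fun h ↦ ?_, fun h ↦ h.comp_linearEquiv φ⟩
  have h' := h.comp_linearEquiv φ.symm
  have hc : ⇑φ.symm ∘ (⇑φ ∘ v) = v := by
    funext j
    simp only [comp_apply]
    exact φ.symm_apply_apply (v j)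
  rwa [hc] at h'

end Transport

namespace ComplexTorus

/-! ### A positively oriented enumeration; the whole torus as a subtorus datum; `[X] = 1` -/

section Univ

variable {ι : Type*} [Fintype ι] [DecidableEq ι] {E : Type*} [NormedAddCommGroup E] [NormedSpace ℂ E]
  (Φ : (ι → ℝ) ≃L[ℝ] E) {N : ℕ}

omit [Fintype ι] in
/-- `orientationSign Φ e = 1` iff the lattice frame of `e` is positively oriented.
[cite: Voisin2002, §11.1.2 Cor. 11.15] -/
theorem orientationSign_eq_one_iff (e : Fin N → ι) :
    orientationSign Φ e = 1 ↔ IsPosOriented (latticeFrame Φ e) := by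
  rw [orientationSign]
  split_ifs with h
  · simp [h]
  · simp [h]

/-- **There is a positively oriented enumeration of the lattice basis** (if one enumeration is
negatively oriented, transpose two of its entries; `N = 2 dim_ℂ E` is `0` or `≥ 2`).
[cite: Voisin2002, §11.1.2 Cor. 11.15] -/
theorem exists_orientationSign_eq_one (e₀ : Fin N ≃ ι) : ∃ e : Fin N ≃ ι, orientationSign Φ e = 1 := by
  classical
  haveI := finiteDimensional_real Φ e₀
  haveI : FiniteDimensional ℂ E := Module.Finite.of_restrictScalars_finite ℝ ℂ E
  have hq := finrank_complex_mul_two Φ e₀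
  set q := Module.finrank ℂ E
  let b : Basis (Fin q) ℂ E := Module.finBasis ℂ E
  by_cases h0 : IsPosOriented (latticeFrame Φ e₀)
  · exact ⟨e₀, (orientationSign_eq_one_iff Φ e₀).2 h0⟩
  · have hq1 : 1 ≤ q := by
      by_contra hlt
      push Not at hlt
      have hq0 : q = 0 := by omega
      apply h0
      rw [isPosOriented_iff hq b]
      haveI : IsEmpty (Fin N) := by
        have : N = 0 := by omega
        subst this
        infer_instance
      rw [Basis.det_apply, Matrix.det_isEmpty]
      exact one_pos
    have hN : 2 ≤ N := by omega
    set i : Fin N := ⟨0, by omega⟩ with hi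
    set j : Fin N := ⟨1, by omega⟩ with hj
    have hij : i ≠ j := by simp [hi, hj, Fin.ext_iff]
    rcases isPosOriented_or_comp_swap hq b (latticeBasis Φ e₀) hij with hpos | hpos
    · exact absurd (by rwa [coe_latticeBasis] at hpos) h0
    · refine ⟨(Equiv.swap i j).trans e₀, (orientationSign_eq_one_iff Φ _).2 ?_⟩
      have hframe : latticeFrame Φ ⇑((Equiv.swap i j).trans e₀) =
          ⇑(latticeBasis Φ e₀) ∘ ⇑(Equiv.swap i j) := by
        funext l
        simp [latticeFrame, latticeBasis_apply]
      rw [hframe]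
      exact hpos

/-- The lattice basis spans `E` over `ℂ` (it is a real basis). [cite: Lange2023AbelianVarietiesComplex, §1.1.2] -/
theorem frameSpan_single_eq_top (e : Fin N ≃ ι) :
    frameSpan Φ (fun j ↦ (Pi.single (e j) (1 : ℤ) : ι → ℤ)) = ⊤ := by
  rw [eq_top_iff]
  intro x _
  have hx : x ∈ Submodule.span ℝ (Set.range ⇑(latticeBasis Φ e)) := by
    rw [(latticeBasis Φ e).span_eq]; exact Submodule.mem_top
  have hrange : Set.range ⇑(latticeBasis Φ e) =
      Set.range (latticeTuple Φ fun j ↦ (Pi.single (e j) (1 : ℤ) : ι → ℤ)) := by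
    rw [coe_latticeBasis, latticeFrame_eq_latticeTuple]
  rw [hrange] at hx
  exact Submodule.span_le_restrictScalars ℝ ℂ _ hx

/-- **The whole torus `X` as a subtorus datum**: the lattice basis in a positively oriented
enumeration `e` (`m = N = 2g`, `W = E`, codimension `0`). [cite: Lange2023AbelianVarietiesComplex, §6.2.4 p. 310] -/
def SubtorusFrame.univ (e : Fin N ≃ ι) (he : orientationSign Φ e = 1) : SubtorusFrame Φ N where
  frame j := Pi.single (e j) 1
  saturated n _ := by
    rw [Submodule.mem_span_range_iff_exists_fun]
    refine ⟨fun j ↦ n (e j), ?_⟩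
    calc ∑ j, n (e j) • (Pi.single (e j) (1 : ℤ) : ι → ℤ)
        = ∑ a, n a • (Pi.single a (1 : ℤ) : ι → ℤ) :=
          e.sum_comp (fun a ↦ n a • (Pi.single a (1 : ℤ) : ι → ℤ))
      _ = ∑ a, (Pi.single a (n a) : ι → ℤ) := by
          refine Finset.sum_congr rfl fun a _ ↦ ?_
          rw [← Pi.single_smul', smul_eq_mul, mul_one]
      _ = n := Finset.univ_sum_single n
  posOriented := by
    have hpos : IsPosOriented (latticeFrame Φ e) := (orientationSign_eq_one_iff Φ e).1 he
    set W := frameSpan Φ (fun j ↦ (Pi.single (e j) (1 : ℤ) : ι → ℤ)) with hW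
    have htop : W = ⊤ := frameSpan_single_eq_top Φ e
    let φ : E ≃ₗ[ℂ] W := (LinearEquiv.ofTop W htop).symm
    have hcomp : frameInSpan Φ (fun j ↦ (Pi.single (e j) (1 : ℤ) : ι → ℤ)) = ⇑φ ∘ latticeFrame Φ e := by
      funext j
      apply Subtype.ext
      rw [coe_frameInSpan, comp_apply, LinearEquiv.coe_ofTop_symm_apply, latticeFrame_eq_latticeTuple]
    rw [hcomp]
    exact hpos.comp_linearEquiv φ

omit [Fintype ι] in
/-- The coordinate matrix of the lattice basis enumerated by `e` against an enumeration `e'` is a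
permutation matrix: its determinant is a unit. [cite: Lange2023AbelianVarietiesComplex, §1.1.2] -/
theorem isUnit_det_single (e e' : Fin N ≃ ι) :
    IsUnit (Matrix.of fun i j ↦ (Pi.single (e j) (1 : ℤ) : ι → ℤ) (e' i)).det := by
  have hM : (Matrix.of fun i j ↦ (Pi.single (e j) (1 : ℤ) : ι → ℤ) (e' i)) =
      (1 : Matrix (Fin N) (Fin N) ℤ).submatrix ⇑(e'.trans e.symm) id := by
    ext i j
    simp only [Matrix.of_apply, Matrix.submatrix_apply, id_eq, Equiv.trans_apply, Matrix.one_apply,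
      Pi.single_apply]
    by_cases h : e' i = e j
    · rw [if_pos h, if_pos (by rw [h, Equiv.symm_apply_apply])]
    · rw [if_neg h, if_neg (fun h' ↦ h (by rw [← h', Equiv.apply_symm_apply]))]
  rw [hM, Matrix.det_permute, Matrix.det_one, mul_one]
  rcases Int.units_eq_one_or (Equiv.Perm.sign (e'.trans e.symm)) with h | h <;> rw [h] <;> simp

/-- **`[X] = 1 ∈ H⁰(X, ℤ)`**: the cycle class of the whole torus (the subtorus datum `univ`, of
codimension `0`) is the constant `1` (Lange (2023), proof of Prop. 6.2.20: `cl(X) = 1`; dually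
`∫_X vol = 1`). [cite: Lange2023AbelianVarietiesComplex, §6.2.4 p. 310] -/
theorem SubtorusFrame.cycleForm_univ (e : Fin N ≃ ι) (he : orientationSign Φ e = 1)
    (e' : Fin (N + 0) ≃ ι) (v : Fin 0 → E) : (SubtorusFrame.univ Φ e he).cycleForm e' v = 1 := by
  refine cycleFormOfFrame_top Φ e' (isUnit_det_single e e') ?_ v
  rw [← latticeFrame_eq_latticeTuple]
  exact (orientationSign_eq_one_iff Φ e).1 he

end Univ

/-! ### Independence of the oriented lattice basis: `[Z]` depends only on the subtorus -/

section FrameChange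

variable {ι : Type*} [DecidableEq ι] {E : Type*} [NormedAddCommGroup E] [NormedSpace ℂ E]
  (Φ : (ι → ℝ) ≃L[ℝ] E) {m k : ℕ}

omit [DecidableEq ι] in
/-- `Φ` is `ℤ`-linear on lattice vectors: `Φ(∑ cᵢ uᵢ) = ∑ cᵢ Φ(uᵢ)`. [cite: Lange2023AbelianVarietiesComplex, §1.1.2] -/
theorem latticeVec_sum_smul (c : Fin m → ℤ) (u : Fin m → (ι → ℤ)) :
    latticeVec Φ (∑ i, c i • u i) = ∑ i, (c i : ℝ) • latticeVec Φ (u i) := by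
  have h : (fun a ↦ (((∑ i, c i • u i) a : ℤ) : ℝ)) = ∑ i, (c i : ℝ) • (fun a ↦ ((u i a : ℤ) : ℝ)) := by
    funext a
    simp only [Finset.sum_apply, Pi.smul_apply, smul_eq_mul]
    push_cast
    rfl
  rw [latticeVec, h, map_sum]
  simp only [map_smul, latticeVec]

omit [DecidableEq ι] in
/-- Integer relations among the `ℤ`-basis of a subtorus frame are trivial: the frame is linearly
independent over `ℤ`. [cite: LangeBirkenhake1992, Exercise 1.1.6 (2)(a)] -/
theorem SubtorusFrame.linearIndependent_int (Z : SubtorusFrame Φ m) : LinearIndependent ℤ Z.frame := by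
  rw [Fintype.linearIndependent_iff]
  intro c hc i
  have hR := (Fintype.linearIndependent_iff.1 Z.linearIndependent) (fun i ↦ (c i : ℝ)) ?_ i
  · exact_mod_cast hR
  · have h := congr_arg (latticeVec Φ) hc
    have h0 : latticeVec Φ (0 : ι → ℤ) = 0 := by
      simp only [latticeVec, Pi.zero_apply, Int.cast_zero]
      exact map_zero Φ
    rw [latticeVec_sum_smul, h0] at h
    simpa only [latticeTuple_apply] using h

namespace SubtorusFrame

variable {Φ}

omit [DecidableEq ι] in
/-- **Change of oriented lattice basis.** If two subtorus data have the same real span `W`, the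
second frame is an integral unimodular combination of the first, `u'ⱼ = ∑ᵢ M i j • uᵢ` with
`M ∈ GL_m(ℤ)`, and every alternating `m`-form takes the value `η(Φu') = det M · η(Φu)` with
`det M = 1`: both frames are `ℤ`-bases of `W ∩ Λ` (saturation) and both are positively oriented.
Hence `η(Φu') = η(Φu)` for every invariant `m`-form `η` — the fundamental classes `∫_Z` agree.
[cite: Voisin2002, §11.1.2 Remark 11.16] -/
theorem apply_latticeTuple_eq_of_realSpan_eq (Z Z' : SubtorusFrame Φ m) (h : Z.realSpan = Z'.realSpan)
    (η : E [⋀^Fin m]→L[ℝ] ℂ) : η (latticeTuple Φ Z'.frame) = η (latticeTuple Φ Z.frame) := by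
  classical
  -- (A) integer transition matrices in both directions
  have hmem' : ∀ j, Z'.frame j ∈ Submodule.span ℤ (Set.range Z.frame) := fun j ↦
    Z.saturated _ (by
      change latticeVec Φ (Z'.frame j) ∈ Z.realSpan
      rw [h]
      exact Submodule.subset_span ⟨j, (latticeTuple_apply Φ Z'.frame j)⟩)
  have hmem : ∀ j, Z.frame j ∈ Submodule.span ℤ (Set.range Z'.frame) := fun j ↦
    Z'.saturated _ (by
      change latticeVec Φ (Z.frame j) ∈ Z'.realSpan
      rw [← h]
      exact Submodule.subset_span ⟨j, (latticeTuple_apply Φ Z.frame j)⟩)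
  choose A hA using fun j ↦ (Submodule.mem_span_range_iff_exists_fun ℤ).1 (hmem' j)
  choose B hB using fun j ↦ (Submodule.mem_span_range_iff_exists_fun ℤ).1 (hmem j)
  -- `M i j = A j i`: `u'_j = ∑ i, M i j • u_i`; `M' i j = B j i`: `u_j = ∑ i, M' i j • u'_i`
  set M : Matrix (Fin m) (Fin m) ℤ := Matrix.of fun i j ↦ A j i with hM
  set M' : Matrix (Fin m) (Fin m) ℤ := Matrix.of fun i j ↦ B j i with hM'
  have hu' : ∀ j, Z'.frame j = ∑ i, M i j • Z.frame i := fun j ↦ by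
    rw [← hA j]; rfl
  have hu : ∀ j, Z.frame j = ∑ i, M' i j • Z'.frame i := fun j ↦ by
    rw [← hB j]; rfl
  -- (B) `M * M' = 1`, so `det M` is a unit
  have hMM' : M * M' = 1 := by
    have hcomb : ∀ j, ∑ l, (M * M') l j • Z.frame l = Z.frame j := fun j ↦ by
      calc ∑ l, (M * M') l j • Z.frame l = ∑ l, ∑ i, (M l i * M' i j) • Z.frame l := by
              simp_rw [Matrix.mul_apply, Finset.sum_smul]
        _ = ∑ i, M' i j • ∑ l, M l i • Z.frame l := by
              rw [Finset.sum_comm]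
              refine Finset.sum_congr rfl fun i _ ↦ ?_
              rw [Finset.smul_sum]
              refine Finset.sum_congr rfl fun l _ ↦ ?_
              rw [smul_smul, mul_comm]
        _ = ∑ i, M' i j • Z'.frame i := by simp_rw [← hu']
        _ = Z.frame j := (hu j).symm
    ext l j
    have hind := Fintype.linearIndependent_iff.1 (Z.linearIndependent_int Φ)
      (fun l' ↦ (M * M') l' j - (1 : Matrix (Fin m) (Fin m) ℤ) l' j) (by
        simp only [sub_smul, Finset.sum_sub_distrib, hcomb j]
        rw [Finset.sum_eq_single j]
        · simp
        · intro l' _ hl'; simp [Matrix.one_apply_ne hl']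
        · intro hj; exact absurd (Finset.mem_univ j) hj) l
    exact sub_eq_zero.1 hind
  have hunit : IsUnit M.det :=
    IsUnit.of_mul_eq_one M'.det (by rw [← Matrix.det_mul, hMM', Matrix.det_one])
  -- (C) real form of the transition: `Φu'_j = ∑ i, (M i j : ℝ) • Φu_i`
  have hreal : latticeTuple Φ Z'.frame = fun j ↦ ∑ i, ((M i j : ℤ) : ℝ) • latticeTuple Φ Z.frame i := by
    funext j
    rw [latticeTuple_apply, hu' j, latticeVec_sum_smul]
    simp only [latticeTuple_apply]
  have hmap : (fun j ↦ ∑ i, ((M i j : ℤ) : ℝ) • latticeTuple Φ Z.frame i) =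
      fun j ↦ ∑ i, (M.map (Int.cast : ℤ → ℝ)) i j • latticeTuple Φ Z.frame i := rfl
  have hdetR : (M.map (Int.cast : ℤ → ℝ)).det = ((M.det : ℤ) : ℝ) := by
    rw [show (Int.cast : ℤ → ℝ) = Int.castRingHom ℝ from rfl, ← RingHom.mapMatrix_apply, ← RingHom.map_det]
  -- (D) `det M > 0` by the orientations, hence `det M = 1`
  have hpos : 0 < ((M.det : ℤ) : ℝ) := by
    obtain ⟨q, hq, b, hb⟩ := Z.posOriented
    -- the complex spans agree; transport the orientation of `Z'` into `frameSpan Φ Z.frame`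
    have hspanC : frameSpan Φ Z'.frame = frameSpan Φ Z.frame := by
      rw [frameSpan, frameSpan, ← Submodule.span_span_of_tower ℝ ℂ (Set.range (latticeTuple Φ Z'.frame)),
        ← Submodule.span_span_of_tower ℝ ℂ (Set.range (latticeTuple Φ Z.frame))]
      change Submodule.span ℂ (Z'.realSpan : Set E) = Submodule.span ℂ (Z.realSpan : Set E)
      rw [h]
    let φ : frameSpan Φ Z'.frame ≃ₗ[ℂ] frameSpan Φ Z.frame := LinearEquiv.ofEq _ _ hspanC
    have hpos' : IsPosOriented (⇑φ ∘ frameInSpan Φ Z'.frame) := Z'.posOriented.comp_linearEquiv φ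
    rw [isPosOriented_iff hq b] at hpos'
    set R := (realBasisOfComplex b).reindex (finCongr hq) with hR
    -- inside `W`: `φ ∘ u'W = ∑ (M i j : ℝ) • uW i`
    have hcombW : (⇑φ ∘ frameInSpan Φ Z'.frame) =
        fun j ↦ ∑ i, ((M i j : ℤ) : ℝ) • frameInSpan Φ Z.frame i := by
      funext j
      apply Subtype.ext
      rw [comp_apply, LinearEquiv.coe_ofEq_apply, coe_frameInSpan, Submodule.coe_sum]
      simp only [Submodule.coe_smul_of_tower, coe_frameInSpan]
      exact congr_fun hreal j
    have hmapW : (fun j ↦ ∑ i, ((M i j : ℤ) : ℝ) • frameInSpan Φ Z.frame i) =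
        fun j ↦ ∑ i, (M.map (Int.cast : ℤ → ℝ)) i j • frameInSpan Φ Z.frame i := rfl
    rw [hcombW, hmapW, AlternatingMap.map_matrix_smul_sum, hdetR, smul_eq_mul] at hpos'
    exact (pos_iff_pos_of_mul_pos hpos').2 hb
  have hdet1 : M.det = 1 := by
    have h1 : (0 : ℤ) < M.det := by exact_mod_cast hpos
    rcases Int.isUnit_iff.1 hunit with h' | h' <;> omega
  -- (E) conclude
  rw [hreal, hmap, ContinuousAlternatingMap.map_matrix_smul_sum, hdetR, hdet1, Int.cast_one, one_smul]

omit [DecidableEq ι] in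
/-- Subtorus data with the same real span present the same subtorus `π(a + W)`.
[cite: LangeBirkenhake1992, Exercise 1.1.6 (2)(a)] -/
theorem carrier_eq_of_realSpan_eq (Z Z' : SubtorusFrame Φ m) (h : Z.realSpan = Z'.realSpan) (a : E) :
    Z.carrier a = Z'.carrier a := by
  rw [carrier, carrier, h]

/-- **The cycle class depends only on the (oriented) complex subtorus, not on the oriented lattice
basis presenting it**: two subtorus data with the same real span `W` (hence the same subtorus
`π(a + W)` and, both being positively oriented for the complex structure of `W`, the same orientation)
have the same cycle class (Voisin (2002), Remark 11.16: `PD([Z])` is the homology class of the oriented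
submanifold `Z`). [cite: Voisin2002, §11.1.2 Remark 11.16] -/
theorem cycleForm_eq_of_realSpan_eq [Fintype ι] (Z Z' : SubtorusFrame Φ m) (h : Z.realSpan = Z'.realSpan)
    (e : Fin (m + k) ≃ ι) : Z.cycleForm e = Z'.cycleForm e :=
  eq_of_forall_torusIntegral_wedge_eq Φ e fun η ↦ by
    rw [torusIntegral_wedge_cycleForm, torusIntegral_wedge_cycleForm,
      apply_latticeTuple_eq_of_realSpan_eq Z Z' h]

/-- The cycle class in the standard enumeration depends only on the subtorus.
[cite: Voisin2002, §11.1.2 Remark 11.16] -/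
theorem cycleClass_eq_of_realSpan_eq [Fintype ι] (Z Z' : SubtorusFrame Φ m) (h : Z.realSpan = Z'.realSpan)
    (p : ℕ) (hp : m + 2 * p = Fintype.card ι) : Z.cycleClass p hp = Z'.cycleClass p hp :=
  cycleForm_eq_of_realSpan_eq Z Z' h _

end SubtorusFrame

end FrameChange

end ComplexTorus

end Literature.Geometry.Kaehler

end
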